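import Summits.ValiantsHypothesis.ValiantsHypothesis.Theorems.VPBoundarySquareNbTransfer
import Literature.Computability.AlgebraicComplexity.Bur26CountingClassVCH
import Literature.Computability.AlgebraicComplexity.Bur24VNPnbInVPSPACE
import HarnessLib

/-!
# VPBoundarySquare — the COMPLETION LADDER of `CollapseEmptiesBoundary` along the
DEFINABILITY of approximations (decomp-valiant lens 3, NODE v8 «NB/CH-COMPLETION»)

The sanctioned split of record of the attacked piece `P = CollapseEmptiesBoundary` (item 23842) is
`P ⟸ PresentableCompletion ∧ CollapseDebordersPresentable` (gen 1; glue item 23460 proved); NODE v7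
made the second child a theorem modulo GRH and one named 2024 fact
(`collapseDebordersPresentable_of_ERH`). This file refines the split along the axis the lens is
about — how DEFINABLE the approximations of a border family are — and moves the theorem-input
residual DOWN a ladder of completion hypotheses, each paired with a collapse partner:

* `NbClosureDefinable` (**U_nb**, route aside 24720): `\overline{VP} ∩ p-fam ⊆ VNPnb^ℂ`.
  `PresentableCompletion ⟹ U_nb` by the landed exponential interpolation
  (`IsPresVPBarFamily.isVNPnbFamily`); `U ⟹ U_nb` (`VNP ⊆ VNPnb`).
  Partner **P_nb**: `VP = VNP ⟹ VNPnb^ℂ ∩ p-fam ⊆ VP` — a THEOREM modulo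
  GRH and Bürgisser 2024 Thm. 4.10 (2) (`collapseDebordersNb_of_ERH`).
* `CHClosureDefinable` (**U_CH**, route aside 24721): `\overline{VP} ∩ p-fam ⊆ VCH^ℂ`, where a
  `VCH^ℂ` family is the specialisation at polynomially many complex constants of an integer family
  in Bürgisser's 2026 algebraic counting class `VCH⁰` (`IsVCH0Family`: exponential format,
  coefficient function in `CH/poly`). `U_nb ⟹ U_CH` is PROVED here modulo the named fact
  `Bur26_cor_4_10` (`VNPnb⁰ ⊆ VCH⁰`): a `VNPnb^ℂ` family is the Boolean sum of a renamed GENERIC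
  computation with variables specialised to constants (`vchSpec_of_isVNPnbFamily`).
  Partner **P_CH**: `VP = VNP ⟹ VCH^ℂ ∩ p-fam ⊆ VP`; its Boolean half
  (`VP = VNP ∧ GRH ⟹ CH ⊆ P/poly`) is the composition of the tree theorems
  `PP_subset_PPoly_of_VP_eq_VNP` and `CH_subset_PPoly_of_PP_subset_PPoly_holds`; its algebraic half
  (Valiant's criterion with `2^{p(n)}` degree / bit-size via the binary model of Bürgisser 2026
  Lemma 4.11) is the open prover task of this rung.
* GLUE (proved): `U_x → P_x → CollapseEmptiesBoundary` for x ∈ {nb, CH}; `P_CH ⟹ P_nb ⟹ P_ε`.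
* CONSTANT-FREE SIBLING RUNG (`constantFree_debordering`): modulo Bürgisser 2026 Cor. 4.4, 4.10,
  4.12, `VP⁰ = VNP⁰` empties the constant-free boundary — the trailing-coefficient closure of
  `VPnb⁰` lands in `VPnb⁰` — with NO GRH and NO completion hypothesis. Over `ℂ` the whole residual
  of the collapse lever is therefore the CH-compressibility of the border constants (`U_CH`).

Honest framing: implications between OPEN statements, two GRH-conditional transfers and three
named 2026 facts used as hypotheses; nothing here proves `VP ≠ VNP`, `\overline{VP} ⊆ VNPnb`,
`\overline{VP} ⊆ VCH^ℂ` or GRH. 0 sorry. No statement of record, split or `closes` changes.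
-/

noncomputable section

set_option linter.dupNamespace false

open MvPolynomial
open Literature.Computability.AlgebraicComplexity
open Literature.NumberTheory.LFunctions (ExtendedRiemannHypothesis)

namespace Summit.ValiantsHypothesis.ValiantsHypothesis.Theorems.VPBoundarySquareCompletionLadder

open Summit.ValiantsHypothesis.ValiantsHypothesis.Theses.VPBoundarySquare
open Summit.ValiantsHypothesis.ValiantsHypothesis.Theorems.VPBoundarySquarePresentableSplit
open Summit.ValiantsHypothesis.ValiantsHypothesis.Theorems.VPBoundarySquareNbTransfer

/-! ## Rung NB: `U_nb = NbClosureDefinable` (route decl) and its collapse partner -/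

/-! Throughout, **P_nb** abbreviates the proposition
`VP ℂ = VNP ℂ → ∀ w g, IsPFamily g → IsVNPnbFamily g → IsPComputable g` ("the collapse de-borders
NB-definable p-families") and **P_CH** the proposition "the collapse de-borders `VCH^ℂ` p-families"
(the hypothesis of `collapseEmptiesBoundary_of_ch`); both are written out in each signature, since
only registered obligations may define propositions under `Summits/`. -/

/-- **GLUE (proved): `U_nb → P_nb → P`.** If border families are NB-definable and the collapse
de-borders NB-definable families, then the collapse closes VP (`CollapseEmptiesBoundary`, item 23842).
[cite: Burgisser2024Completeness, Thm. 4.10 (2)] -/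
theorem collapseEmptiesBoundary_of_nb (hU : NbClosureDefinable)
    (hP : (VP ℂ = VNP ℂ → ∀ (w : ℕ → ℕ) (g : ∀ n, MvPolynomial (Fin (w n)) ℂ),
        IsPFamily g → IsVNPnbFamily g → IsPComputable g)) :
    CollapseEmptiesBoundary :=
  fun hEq v f hpf hbar => hP hEq v f hpf (hU v f hpf hbar)

/-- **P_nb is a theorem modulo GRH and Bürgisser 2024 Thm. 4.10 (2)**: under the collapse
`VNPnb ∩ p-fam ⊆ VPnb ∩ p-fam`, and a `VPnb` family IS a family of p-bounded complexity
(`isVPnbFamily_iff_isPComputable`). [cite: Burgisser2024Completeness, Thm. 4.10 (2) (p0017 L63–L103)] -/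
theorem collapseDebordersNb_of_ERH (hGRH : ExtendedRiemannHypothesis) (h410 : Bur24_thm_4_10_2 ℂ) :
    (VP ℂ = VNP ℂ → ∀ (w : ℕ → ℕ) (g : ∀ n, MvPolynomial (Fin (w n)) ℂ),
      IsPFamily g → IsVNPnbFamily g → IsPComputable g) :=
  fun hEq v f _ hf => ((isVPnbFamily_iff_isPComputable f).1 (h410 hGRH hEq v f hf)).2

/-- **`PresentableCompletion → U_nb`** (the v8 theorem-input child is WEAKER than the v6/v7 one):
`\overline{VP} ⊆ \overline{VP}_ε ⊆ VNPnb` on p-families, the second inclusion being the landed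
exponential interpolation. [cite: BhargavDwivediSaxena2024, Lemma 4.1 (p. 13)] -/
theorem nbClosureDefinable_of_presentableCompletion (hC : PresentableCompletion) : NbClosureDefinable :=
  fun v f hpf hbar => (hC v f hpf hbar).isVNPnbFamily hpf

/-- **`U → U_nb`** (`VNP ⊆ VNPnb`). [cite: Burgisser2024Completeness, §4.2 (p0016 L8–L9)] -/
theorem nbClosureDefinable_of_closureDefinable (hU : ClosureDefinable) : NbClosureDefinable :=
  fun v f hpf hbar => (hU v f hpf hbar).isVNPnbFamily

/-- **`U_nb ∧ B_nb → U`**: NB-definability of the closure plus `VNPnb ∩ p-fam ⊆ VNP`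
(`BooleanNbDefinable`, item 23487) give closure-definability; so `U ⟺ U_nb ∧ (B_nb on the closure)`.
[cite: BhargavDwivediSaxena2024, §6 (p. 16)] -/
theorem closureDefinable_of_nb_of_booleanNbDefinable (hU : NbClosureDefinable)
    (hB : BooleanNbDefinable) : ClosureDefinable :=
  fun v f hpf hbar => hB v f hpf (hU v f hpf hbar)

/-- **`P_nb ∧ U_nb`-form of K2: under GRH ∧ Thm 4.10(2) the route's open content is
`EmptyBoundarySeparates ∧ NbClosureDefinable`** (fed through the route's own `closes`).
[cite: Burgisser2024Completeness, Thm. 4.10 (2)] -/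
theorem valiant_of_ERH_of_Q_of_nbCompletion (hGRH : ExtendedRiemannHypothesis)
    (h410 : Bur24_thm_4_10_2 ℂ) (hQ : EmptyBoundarySeparates) (hU : NbClosureDefinable) :
    ValiantsHypothesis :=
  closes hQ (collapseEmptiesBoundary_of_nb hU (collapseDebordersNb_of_ERH hGRH h410))

/-- **The NB boundary separates (under GRH ∧ Thm 4.10(2))**: ONE p-family on `Fin (v n)` in
`VNPnb^ℂ` that is not p-computable proves `VP_ℂ ≠ VNP_ℂ`.
[cite: Burgisser2024Completeness, Thm. 4.10 (2)] -/
theorem valiant_of_ERH_of_nbWitness (hGRH : ExtendedRiemannHypothesis) (h410 : Bur24_thm_4_10_2 ℂ)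
    {v : ℕ → ℕ} {f : ∀ n, MvPolynomial (Fin (v n)) ℂ} (hpf : IsPFamily f) (hf : IsVNPnbFamily f)
    (hnc : ¬ IsPComputable f) : ValiantsHypothesis := by
  intro hEq
  exact hnc (collapseDebordersNb_of_ERH hGRH h410 hEq v f hpf hf)

/-- **P_nb → P_ε** (the v8 collapse child implies the v7 one: `\overline{VP}_ε ∩ p-fam ⊆ VNPnb`).
[cite: BhargavDwivediSaxena2024, Lemma 4.1 (p. 13)] -/
theorem collapseDebordersPresentable_of_collapseDebordersNb
    (hP : (VP ℂ = VNP ℂ → ∀ (w : ℕ → ℕ) (g : ∀ n, MvPolynomial (Fin (w n)) ℂ),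
        IsPFamily g → IsVNPnbFamily g → IsPComputable g)) :
    CollapseDebordersPresentable :=
  fun hEq v f hpf hbar => hP hEq v f hpf (hbar.isVNPnbFamily hpf)

/-- **B_nb → P_nb** (if `VNPnb ∩ p-fam ⊆ VNP` outright, the collapse de-borders it with no GRH).
[cite: BhargavDwivediSaxena2024, §6 (p. 16)] -/
theorem collapseDebordersNb_of_booleanNbDefinable (hB : BooleanNbDefinable) :
    (VP ℂ = VNP ℂ → ∀ (w : ℕ → ℕ) (g : ∀ n, MvPolynomial (Fin (w n)) ℂ),
      IsPFamily g → IsVNPnbFamily g → IsPComputable g) :=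
  fun hEq v f hpf hf => isPComputable_of_isVNPFamily_of_vp_eq_vnp hEq (hB v f hpf hf)


/-- **`U_nb ∧ B_nb ⟹ P` with no GRH.** [cite: BhargavDwivediSaxena2024, §6 (p. 16)] -/
theorem collapseEmptiesBoundary_of_nb_of_booleanNbDefinable (hU : NbClosureDefinable)
    (hB : BooleanNbDefinable) : CollapseEmptiesBoundary :=
  collapseEmptiesBoundary_of_nb hU (collapseDebordersNb_of_booleanNbDefinable hB)

/-! ### Boolean sums under a change of scalars -/

/-- Change of scalars commutes with Valiant's Boolean sum. [cite: Burgisser2000, Def. 2.4–2.5] -/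
theorem map_boolSum' {R S : Type*} [CommSemiring R] [CommSemiring S] (ι : R →+* S) {τ : Type*}
    {m : ℕ} (g : MvPolynomial (τ ⊕ Fin m) R) :
    MvPolynomial.map ι (boolSum g) = boolSum (MvPolynomial.map ι g) := by
  unfold boolSum
  rw [map_sum]
  refine Finset.sum_congr rfl fun e _ => ?_
  show MvPolynomial.map ι (bind₁ _ g) = bind₁ _ (MvPolynomial.map ι g)
  rw [map_bind₁]
  exact congrArg (fun θ : τ ⊕ Fin m → MvPolynomial τ S => bind₁ θ (MvPolynomial.map ι g))
    (funext fun i => by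
      rcases i with x | j
      · simp
      · by_cases h : e j <;> simp [h])

/-- Substituting into the free variables of a Boolean sum (the summation variables untouched);
the tree's `boolSum_aeval_extend` (VNPClosedUnderDifferentiation.lean), re-proved here to keep the
import closure small. [cite: Burgisser2000, Def. 2.4–2.5] -/
theorem boolSum_aeval_extend' {R : Type*} [CommSemiring R] {σ ρ : Type*} {u : ℕ}
    (θ : σ → MvPolynomial ρ R) (g : MvPolynomial (σ ⊕ Fin u) R) :
    boolSum (aeval (Sum.elim (fun w => rename Sum.inl (θ w)) (fun j => X (Sum.inr j))) g) =
      aeval θ (boolSum g) := by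
  unfold boolSum
  rw [map_sum]
  refine Finset.sum_congr rfl fun e _ => ?_
  rw [← AlgHom.comp_apply, ← AlgHom.comp_apply]
  congr 1
  refine algHom_ext fun x => ?_
  rcases x with w | j
  · rw [AlgHom.comp_apply, AlgHom.comp_apply, aeval_X, aeval_X, Sum.elim_inl, Sum.elim_inl,
      aeval_rename, aeval_X]
    have : (Sum.elim X (fun j => if e j then (1 : MvPolynomial ρ R) else 0)) ∘ Sum.inl = X := by
      ext1; rfl
    rw [this, aeval_X_left_apply]
  · rw [AlgHom.comp_apply, AlgHom.comp_apply, aeval_X, aeval_X, Sum.elim_inr, Sum.elim_inr,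
      aeval_X, Sum.elim_inr]
    split_ifs <;> simp

/-! ### `VNPnb^ℂ` p-families are specialisations of `VNPnb⁰ ⊆ VCH⁰` families -/

/-- **`VNPnb^ℂ ⊆ VCH^ℂ` (modulo Bürgisser 2026 Cor. 4.10 `VNPnb⁰ ⊆ VCH⁰`).** A `VNPnb` family over
`ℂ` in the variables `Fin (v n)`, `v` p-bounded, is the specialisation at polynomially many complex
constants of an integer `VNPnb⁰` family — the Boolean sum of the renamed generic computation
`G_{t(n)}` (Bürgisser 2024 §4.2 "obtained from the universal classes by specializing variables to
constants"), hence of a `VCH⁰` family.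
[cite: Burgisser2024Completeness, §4.2 (p0016 L8–L11)] [cite: Burgisser2026HNC, Cor. 4.10 (p. 13)] -/
theorem vchSpec_of_isVNPnbFamily (h410 : Bur26_cor_4_10) {v : ℕ → ℕ}
    {f : ∀ n, MvPolynomial (Fin (v n)) ℂ} (hv : IsPBounded v) (hf : IsVNPnbFamily f) :
    ∃ (w : ℕ → ℕ) (Q : ∀ n, MvPolynomial (Fin (v n + w n)) ℤ) (κ : ∀ n, Fin (w n) → ℂ),
      IsVCH0Family Q ∧ ∀ n, f n = MvPolynomial.aeval (Fin.append MvPolynomial.X fun j => MvPolynomial.C (κ n j))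
        (MvPolynomial.map (Int.castRingHom ℂ) (Q n)) := by
  classical
  obtain ⟨u, g, hg, hfg⟩ := hf
  have hu : IsPBounded u := hg.1.mono fun n => by simp [Fintype.card_sum, Fintype.card_fin]
  obtain ⟨-, t, ht, hφ⟩ := (Bur24_sec4_2_isVPnbFamily_iff_specialisation g).1 hg
  choose φ hφv hgφ using hφ
  -- one constant slot per variable of `G_{t n}`
  let w : ℕ → ℕ := fun n => Fintype.card (MalodGeneric.Var (t n))
  let e : ∀ n, MalodGeneric.Var (t n) ≃ Fin (w n) := fun n => Fintype.equivFin _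
  obtain ⟨ρ, hρ⟩ : ∃ ρ : ∀ n, MalodGeneric.Var (t n) → Fin (v n + w n) ⊕ Fin (u n), ∀ n i,
      ρ n i = if h : ∃ x, φ n i = X x then Sum.map (Fin.castAdd (w n)) id h.choose
        else Sum.inl (Fin.natAdd (v n) (e n i)) :=
    ⟨_, fun _ _ => rfl⟩
  obtain ⟨κ, hκ⟩ : ∃ κ : ∀ n, Fin (w n) → ℂ, ∀ n j,
      κ n j = if h : ∃ c, φ n ((e n).symm j) = C c then h.choose else 0 :=
    ⟨_, fun _ _ => rfl⟩
  -- the substitution seen by the summand after `boolSum_aeval_extend`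
  let θ : ∀ n, Fin (v n + w n) → MvPolynomial (Fin (v n)) ℂ :=
    fun n => Fin.append MvPolynomial.X fun j => MvPolynomial.C (κ n j)
  let Θ : ∀ n, Fin (v n + w n) ⊕ Fin (u n) → MvPolynomial (Fin (v n) ⊕ Fin (u n)) ℂ :=
    fun n => Sum.elim (fun y => rename Sum.inl (θ n y)) fun j => X (Sum.inr j)
  have hΘX : ∀ n (s : Fin (v n) ⊕ Fin (u n)), Θ n (Sum.map (Fin.castAdd (w n)) id s) = X s := by
    intro n s
    rcases s with y | j
    · simp [Θ, θ, Fin.append_left, rename_X]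
    · simp [Θ]
  have hcomp : ∀ n i, Θ n (ρ n i) = φ n i := by
    intro n i
    rw [hρ]
    split_ifs with h
    · rw [hΘX, ← h.choose_spec]
    · rcases hφv n i with hx | ⟨c, hc⟩
      · exact absurd hx h
      · have h' : ∃ c', φ n ((e n).symm (e n i)) = C c' :=
          ⟨c, by rw [Equiv.symm_apply_apply, hc]⟩
        simp only [Θ, θ, Sum.elim_inl, Fin.append_right, rename_C]
        rw [hκ, dif_pos h']
        calc C h'.choose = φ n ((e n).symm (e n i)) := h'.choose_spec.symm
          _ = φ n i := congrArg (φ n) (Equiv.symm_apply_apply _ _)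
  have hG := isVPnb0Family_genericComputation_comp ht
  have hcard : IsPBounded fun n => Fintype.card (Fin (v n + w n) ⊕ Fin (u n)) :=
    (IsPBounded.add_holds (IsPBounded.add_holds hv hG.1) hu).mono fun n => by
      simp [w, Fintype.card_sum, Fintype.card_fin]
  refine ⟨w, fun n => boolSum (rename (ρ n) (MalodGeneric.genericComputation ℤ (t n))), κ,
    h410 _ _ ⟨u, fun n => rename (ρ n) (MalodGeneric.genericComputation ℤ (t n)), hG.rename ρ hcard,
      fun n => rfl⟩, fun n => ?_⟩
  have hfun : (Θ n ∘ ρ n) = φ n := funext fun i => hcomp n i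
  rw [hfg n, hgφ n, map_boolSum', MvPolynomial.map_rename, MalodGeneric.map_genericComputation,
    ← boolSum_aeval_extend', MvPolynomial.aeval_rename]
  exact congrArg (fun ψ => boolSum (aeval ψ (MalodGeneric.genericComputation ℂ (t n)))) hfun.symm

/-! ## Rung CH: `U_CH = CHClosureDefinable` (route decl) and its collapse partner -/

/-! ### The ladder `U_nb ⟹ U_CH` and the glue `U_CH → P_CH → P` -/

/-- **GLUE (proved): `U_CH → P_CH → P`.** [cite: Burgisser2026HNC, Def. 4.2 (p. 11)] -/
theorem collapseEmptiesBoundary_of_ch (hU : CHClosureDefinable)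
    (hP : (VP ℂ = VNP ℂ → ∀ (w : ℕ → ℕ) (g : ∀ n, MvPolynomial (Fin (w n)) ℂ), IsPFamily g →
        (∃ (m : ℕ → ℕ) (Q : ∀ n, MvPolynomial (Fin (w n + m n)) ℤ) (κ : ∀ n, Fin (m n) → ℂ),
          IsVCH0Family Q ∧ ∀ n, g n = MvPolynomial.aeval (Fin.append MvPolynomial.X fun j =>
            MvPolynomial.C (κ n j)) (MvPolynomial.map (Int.castRingHom ℂ) (Q n))) → IsPComputable g)) :
    CollapseEmptiesBoundary :=
  fun hEq v f hpf hbar => hP hEq v f hpf (hU v f hpf hbar)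

/-- **`U_nb ⟹ U_CH`** (modulo `Bur26_cor_4_10 : VNPnb⁰ ⊆ VCH⁰`): the ladder descends.
[cite: Burgisser2026HNC, Cor. 4.10 (p. 13)] -/
theorem chClosureDefinable_of_nb (h410 : Bur26_cor_4_10) (hU : NbClosureDefinable) :
    CHClosureDefinable :=
  fun v f hpf hbar => vchSpec_of_isVNPnbFamily h410 (hpf.1.mono fun n => by simp) (hU v f hpf hbar)

/-- **`P_CH ⟹ P_nb`** (modulo `Bur26_cor_4_10`). [cite: Burgisser2026HNC, Cor. 4.10 (p. 13)] -/
theorem collapseDebordersNb_of_ch (h410 : Bur26_cor_4_10)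
    (hP : (VP ℂ = VNP ℂ → ∀ (w : ℕ → ℕ) (g : ∀ n, MvPolynomial (Fin (w n)) ℂ), IsPFamily g →
        (∃ (m : ℕ → ℕ) (Q : ∀ n, MvPolynomial (Fin (w n + m n)) ℤ) (κ : ∀ n, Fin (m n) → ℂ),
          IsVCH0Family Q ∧ ∀ n, g n = MvPolynomial.aeval (Fin.append MvPolynomial.X fun j =>
            MvPolynomial.C (κ n j)) (MvPolynomial.map (Int.castRingHom ℂ) (Q n))) → IsPComputable g)) :
    (VP ℂ = VNP ℂ → ∀ (w : ℕ → ℕ) (g : ∀ n, MvPolynomial (Fin (w n)) ℂ),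
      IsPFamily g → IsVNPnbFamily g → IsPComputable g) :=
  fun hEq v f hpf hf => hP hEq v f hpf (vchSpec_of_isVNPnbFamily h410 (hpf.1.mono fun n => by simp) hf)

/-- **`PresentableCompletion ⟹ U_CH`** (via `U_nb`). [cite: BhargavDwivediSaxena2024, Lemma 4.1 (p. 13)] -/
theorem chClosureDefinable_of_presentableCompletion (h410 : Bur26_cor_4_10)
    (hC : PresentableCompletion) : CHClosureDefinable :=
  chClosureDefinable_of_nb h410 fun v f hpf hbar => (hC v f hpf hbar).isVNPnbFamily hpf

/-- **Under `P_CH` the route's open content is `EmptyBoundarySeparates ∧ CHClosureDefinable`**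
(fed through the route's own `closes`). [cite: Burgisser2026HNC, Cor. 4.12 (p. 14)] -/
theorem valiant_of_Q_of_chCompletion (hQ : EmptyBoundarySeparates) (hU : CHClosureDefinable)
    (hP : (VP ℂ = VNP ℂ → ∀ (w : ℕ → ℕ) (g : ∀ n, MvPolynomial (Fin (w n)) ℂ), IsPFamily g →
        (∃ (m : ℕ → ℕ) (Q : ∀ n, MvPolynomial (Fin (w n + m n)) ℤ) (κ : ∀ n, Fin (m n) → ℂ),
          IsVCH0Family Q ∧ ∀ n, g n = MvPolynomial.aeval (Fin.append MvPolynomial.X fun j =>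
            MvPolynomial.C (κ n j)) (MvPolynomial.map (Int.castRingHom ℂ) (Q n))) → IsPComputable g)) :
    ValiantsHypothesis :=
  closes hQ (collapseEmptiesBoundary_of_ch hU hP)

/-! ### The constant-free sibling rung: `VP⁰ = VNP⁰` empties the constant-free boundary -/

/-- **CONSTANT-FREE SIBLING RUNG.** Modulo Bürgisser 2026 Cor. 4.4 (`\overline{VCH⁰} = VCH⁰`),
Cor. 4.10 (`VNPnb⁰ ⊆ VCH⁰`) and Cor. 4.12 (`VP⁰ = VNP⁰ ⟹ VCH⁰ ⊆ VPnb⁰`): if `VP⁰ = VNP⁰` then every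
exponential-format trailing coefficient (`t`-adic limit) of a `VPnb⁰` family is again in `VPnb⁰` —
the constant-free collapse empties the constant-free boundary, with no GRH and no completion
hypothesis. [cite: Burgisser2026HNC, Cor. 4.4 (p. 12), Cor. 4.10 (p. 13), Cor. 4.12 (p. 14)] -/
theorem constantFree_debordering (h44 : Bur26_cor_4_4) (h410 : Bur26_cor_4_10)
    (h412 : Bur26_cor_4_12)
    (hEq : ∀ (w : ℕ → ℕ) (g : ∀ n, MvPolynomial (Fin (w n)) ℤ), IsVNP0Family g → IsVP0Family g)
    {v : ℕ → ℕ} {f : ∀ n, MvPolynomial (Fin (v n)) ℤ} (hf : IsExpFormat f)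
    (e : ℕ → ℕ) (F : ∀ n, MvPolynomial (Fin (v n + 1)) ℤ) (hF : IsVPnb0Family F)
    (hlim : ∀ n, f n = 0 ∨ IsTrailingCoeff (e n) (F n) (f n)) : IsVPnb0Family f :=
  isVPnb0Family_of_isVCH0BarFamily h44 h412 hEq
    (isVCH0BarFamily_intro hf e F (hF.isVCH0Family_of h410) hlim)


/-- **`P_CH ⟹ P_ε`** (the CH collapse partner implies the v7 one).
[cite: BhargavDwivediSaxena2024, Lemma 4.1 (p. 13)] -/
theorem collapseDebordersPresentable_of_ch (h410 : Bur26_cor_4_10)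
    (hP : (VP ℂ = VNP ℂ → ∀ (w : ℕ → ℕ) (g : ∀ n, MvPolynomial (Fin (w n)) ℂ), IsPFamily g →
        (∃ (m : ℕ → ℕ) (Q : ∀ n, MvPolynomial (Fin (w n + m n)) ℤ) (κ : ∀ n, Fin (m n) → ℂ),
          IsVCH0Family Q ∧ ∀ n, g n = MvPolynomial.aeval (Fin.append MvPolynomial.X fun j =>
            MvPolynomial.C (κ n j)) (MvPolynomial.map (Int.castRingHom ℂ) (Q n))) → IsPComputable g)) :
    CollapseDebordersPresentable :=
  collapseDebordersPresentable_of_collapseDebordersNb (collapseDebordersNb_of_ch h410 hP)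

end Summit.ValiantsHypothesis.ValiantsHypothesis.Theorems.VPBoundarySquareCompletionLadder

end
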